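import Summits.QuantumFields.BalabanUV.Beta.FP.SliceVertex2
import Literature.MathematicalPhysics.QuantumFieldTheory.Balaban1983to89.Beta.BalabanCompositeJets

/-!
# `BalabanUV.Beta.FP.SliceBiStencil` — road «FP» for binder row D1, row H2V-2 part 4 (owner «GO sliceW4», CLAIMS 2026-08-21 l.28064 (1)):
# THE PACKED SECOND-ORDER TABLE `sliceW` OF THE BACKGROUND-FEYNMAN SLICE («`sliceW4`» of H2V-DESIGN §1 = the explicit slice summand of `PiBF`'s W-slot),
# its closed form, support, the `VertexFamily₂` ∕ `LocStencil₂` letters with EXPLICIT constants, symmetry and translation covariance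

HONEST DEPENDENCY (page 1, mandatory): continuum YM on T⁴ ⇐ BetaPertH ∧ nine spine estimates (0/9 proved); BetaPertH ⇐ (D1) ∧ (D4) ∧ CAP+tail;
G-an2-4 gates asym, D1 and NE2/3/4.  HONEST FRAMING (cell contract, verbatim): «discharging `BetaPertH` makes Bałaban's UV stability UNCONDITIONAL —
a real constructive-QFT result; it is NOT the continuum limit and NOT the Clay problem.»  THIS MODULE DISCHARGES NOTHING of the wall: one data definition and
finite bookkeeping over `SliceVertex2.sEntry₂` (closed form `sEntry₂_apply` ✓, ring-level certificate `sliceJet22P_field_bondLetter₂` ✓) and `SliceVertex.sEntry`;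
`[our object]`∕`[folklore]`, nothing cited, no `def … : Prop`, no `sorry`; the pattern is an3's `WilsonBiStencil` (the Wilson W-slot `wilsonW₂`) and H2V-2's `sliceA`.
NOT the perfect action's quartic jet `S∞⁴` (H2V-4′), NOT (a8)∕(Kcov) (part 5), NOT hgerm, NOT D1, NOT BetaPertH, NOT continuum, NOT Clay.

ABSOLUTE RULE (cell charter, verbatim): «No internally-minted statement may enter as a cited fact. Every hypothesis is either kernel-proved in this package or a
verbatim quotation of a PUBLISHED theorem with page reference. The manuscript(s) under audit are NOT citable for their own disputed steps — they are the thing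
under adjudication; programme-internal (2001/route/tribunal) claims are never citable.»

THE CONVENTION (why `sEntry₂ + sEntry₂ᵀ`).  The road's Hessian kernel `hessKer A V W = ½·tadpole A (W μ 0 ν z) − ½·bubble A (V μ 0) (V ν z)` reads `V_b = ∂H∕∂y_b` and
`W_{bb′} = ∂²H∕∂y_b∂y_{b′}` of the stripped fluctuation Hessian `H(y)` (`S₂ = ½·vᵀH(y)v`, one scalar `y_b` per background bond after the colour words are replaced by `1`,
`StepJetData` §5).  `SliceVertex2.sliceJet22P_field_bondLetter₂` gives the polarised `(2,2)` jet as `½·vᵀM_{bb′}v` with `M_{bb′} = sliceVertex₂`, so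
`H₂(y) = Σ_{b,b′} y_b y_{b′}·sym(M_{bb′})` and `∂²H₂∕∂y_b∂y_{b′} = 2·sym(M_{bb′}) = M_{bb′} + M_{bb′}ᵀ` — the quadratic form sees the symmetric part, and the two colour
words are each other's transpose (`SliceVertex2.adM₂_transpose`).  THE SIGN: the first-order word is stripped as the coefficient of an3's `adM Y = τ(Y·[t_a,t_b])
= +(gram·ad_Y)_{ab}`, the second-order word as the coefficient of `adM₂ Y₁ Y₂ = τ(t_a·[Y₁,[Y₂,t_b]]) = −(gram·ad_{Y₁}ad_{Y₂})_{ab}` (ONE bracket moved across the tracial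
`τ`): in the UNIFORM convention «colourless table := coefficient of `gram·(ad-word)`», which gives the tadpole and the bubble of `hessKer` the SAME colour factor
`tr(ad_c ad_d)`, the W-slot is therefore MINUS the `A ↦ 1` instance — hence the overall `−` in the field block below.  The sign is CERTIFIED by the kernel in part 5
(`FP/SliceBiStencilWard.divW_sliceW`): the pair `(sliceA, sliceW)` obeys the (a8) letter of `PerfectPolarizationWardLetters.wardTransversal_flip_PiBF_of_gauge_laws`
with the SAME constant `c = 1` as gan24-leaf-02's (a4) letter `SliceGaugeLaw.divV_sliceA` (with `+` instead of `−` it would be `c = −1`).  The multiplier blocks are zero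
as for `sliceA` ∕ `wilsonW₂`.

WHAT IS PROVED (general `d`; `b = (κ,u)`, `b′ = (κ′,u′)` the two background bonds).
* §1 [our object] **`sliceW d κ u κ′ u′ : MKer (d+1) (Fib d)`**, ff block `−(sEntry₂ d κ u κ′ u′ x w α β + sEntry₂ d κ u κ′ u′ w x β α)`; closed form **`sliceW_inl_inl_apply`**:
  `−[u+e_κ = u′+e_{κ′}]·([x=u∧α=κ][w=u′∧β=κ′] + [w=u∧β=κ][x=u′∧α=κ′]) + ½·[b=b′]·(sEntry d κ u w x β α + sEntry d κ u x w α β)` — MINUS the polarised `T₁T₁` word (both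
  background bonds END at the same site, one fluctuation leg pinned at each) and, on the diagonal, PLUS the symmetrised first-order slice entry; leg symmetry
  `sliceW_symm`, bond symmetry `sliceW_swap`.
* §2 SUPPORT AND SIZE: `abs_sEntry₂_le : |sEntry₂| ≤ 2`, `sEntry₂_eq_zero_or` (an entry vanishes unless `|x−u|₁ ≤ 2 ∧ |w−u′|₁ ≤ 2 ∧ |u′−u|₁ ≤ 2`), `abs_sliceW_le : |sliceW| ≤ 4`,
  **`sliceW_eq_zero_of_two_lt`** (the family VANISHES unless the two background bonds are within `ℓ¹`-distance 2).
* §3 THE LETTERS, for EVERY rate `δ ≥ 0`, constants DISPLAYED: **`biLoc_sliceW_pair : BiLoc (sliceW d κ u κ′ u′) u u′ (4·e^{8δ}) δ`** (the `VertexFamily₂` shape at `N = 1`: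
  **`Cw := 4·e^{8δ}`**; the transposed entry re-centres each leg across the ≤ 2 bond separation), **`biLoc_sliceW : BiLoc (sliceW d κ u κ′ u′) u u (4·e^{12δ}·e^{−δ|u′−u|₁}) δ`** and
  `locStencil₂_sliceW : LocStencil₂ (sliceW d) (4·e^{12δ}) δ` (the one-shot consumer's shape: **`CwL := 4·e^{12δ}`**).
* §4 COVARIANCE: **`sliceW_translate : sliceW d κ (u + v) κ′ (u′ + v) = shiftK (−v) (sliceW d κ u κ′ u′)`**.
Provenance: D1 formalisation swarm seat b2b-balaban-beta-d1-formalise-leaf-02 gen 10 (road FP engine lineage), 2026-08-21.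
-/

noncomputable section

namespace Summit.QuantumFields.BalabanUV.Beta.FP.SliceBiStencil

open Finset
open scoped BigOperators
open Literature.MathematicalPhysics.QuantumFieldTheory.Balaban1983to89
open Literature.MathematicalPhysics.QuantumFieldTheory.Balaban1983to89.Beta
open ExpKernelCalculus (MKer BiLoc shiftK)
open OneStepResolventKernel (Fib)
open BalabanCompositeJets (LocStencil₂)
open StepJetData (l1_unitVec l1_add_le)
open OneStepKernelFamily (l1_neg_eq)
open B12Sec2to5 (l1 l1_nonneg)
open B6BondElimination (unitVec unitVec_apply)
open Summit.QuantumFields.BalabanUV.Beta.FP.SliceVertex (sEntry sEntry_apply abs_sEntry_le sEntry_eq_zero_or)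
open Summit.QuantumFields.BalabanUV.Beta.FP.SliceVertex2 (sEntry₂ sEntry₂_apply sEntry₂_eq_sEntry sEntry₂_translate)

variable {d : ℕ}

/-! ## §1 The packed table and its closed form -/

/-- [our object] **THE SLICE'S PACKED SECOND-ORDER TABLE** `sliceW d κ u κ′ u′` at the ordered pair of background bonds `(κ,u)`, `(κ′,u′)`: on the field block
`−(sEntry₂ + sEntry₂ᵀ)` (`= ∂²H∕∂y_b∂y_{b′}` of the stripped Hessian in `hessKer`'s uniform colour convention — see the header for the sign), zero on every block touching a
multiplier leg.  A definition asserting nothing. -/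
def sliceW (d : ℕ) (κ : Fin (d + 1)) (u : Fin (d + 1) → ℤ) (κ' : Fin (d + 1)) (u' : Fin (d + 1) → ℤ) : MKer (d + 1) (Fib d) :=
  fun x w a b =>
    match a, b with
    | Sum.inl α, Sum.inl β => -(sEntry₂ d κ u κ' u' x w α β + sEntry₂ d κ u κ' u' w x β α)
    | Sum.inl _, Sum.inr _ => 0
    | Sum.inr _, Sum.inl _ => 0
    | Sum.inr _, Sum.inr _ => 0

/-- [folklore] the field–field block (definitional). -/
theorem sliceW_inl_inl (κ : Fin (d + 1)) (u : Fin (d + 1) → ℤ) (κ' : Fin (d + 1)) (u' x w : Fin (d + 1) → ℤ) (α β : Fin (d + 1)) :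
    sliceW d κ u κ' u' x w (Sum.inl α) (Sum.inl β) = -(sEntry₂ d κ u κ' u' x w α β + sEntry₂ d κ u κ' u' w x β α) := rfl

/-- [folklore] **CLOSED FORM OF THE FIELD BLOCK**: the polarised `T₁T₁` word plus, on the diagonal, minus the symmetrised first-order slice entry. -/
theorem sliceW_inl_inl_apply (κ : Fin (d + 1)) (u : Fin (d + 1) → ℤ) (κ' : Fin (d + 1)) (u' x w : Fin (d + 1) → ℤ) (α β : Fin (d + 1)) :
    sliceW d κ u κ' u' x w (Sum.inl α) (Sum.inl β) =
      -((if u + unitVec κ = u' + unitVec κ' then (1 : ℝ) else 0) *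
          ((if x = u ∧ α = κ then (1 : ℝ) else 0) * (if w = u' ∧ β = κ' then 1 else 0)
            + (if w = u ∧ β = κ then (1 : ℝ) else 0) * (if x = u' ∧ α = κ' then 1 else 0)))
        + (2 : ℝ)⁻¹ * (if u = u' ∧ κ = κ' then (1 : ℝ) else 0) * (sEntry d κ u w x β α + sEntry d κ u x w α β) := by
  rw [sliceW_inl_inl, sEntry₂_eq_sEntry, sEntry₂_eq_sEntry]
  ring

/-- [folklore] **LEG SYMMETRY**: `sliceW` is a symmetric table. -/
theorem sliceW_symm (κ : Fin (d + 1)) (u : Fin (d + 1) → ℤ) (κ' : Fin (d + 1)) (u' x w : Fin (d + 1) → ℤ) (a b : Fib d) :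
    sliceW d κ u κ' u' w x b a = sliceW d κ u κ' u' x w a b := by
  rcases a with α | α <;> rcases b with β | β
  · show -(sEntry₂ d κ u κ' u' w x β α + sEntry₂ d κ u κ' u' x w α β) = -(sEntry₂ d κ u κ' u' x w α β + sEntry₂ d κ u κ' u' w x β α)
    rw [add_comm]
  all_goals rfl

/-- [folklore] **BOND SYMMETRY**: `sliceW d κ′ u′ κ u = sliceW d κ u κ′ u′` (the polarised jet is symmetric, `SliceVertex2.sliceJet22P_comm`; off the diagonal the
`T₁T₁` word is symmetric under exchanging the bonds together with the legs, on the diagonal there is nothing to exchange). -/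
theorem sliceW_swap (κ : Fin (d + 1)) (u : Fin (d + 1) → ℤ) (κ' : Fin (d + 1)) (u' : Fin (d + 1) → ℤ) :
    sliceW d κ' u' κ u = sliceW d κ u κ' u' := by
  by_cases hb : u = u' ∧ κ = κ'
  · obtain ⟨rfl, rfl⟩ := hb; rfl
  · have hb' : ¬(u' = u ∧ κ' = κ) := fun h => hb ⟨h.1.symm, h.2.symm⟩
    have e : (u' + unitVec κ' = u + unitVec κ) ↔ (u + unitVec κ = u' + unitVec κ') := eq_comm
    funext x w a b
    rcases a with α | α <;> rcases b with β | β
    · rw [sliceW_inl_inl_apply, sliceW_inl_inl_apply, if_neg hb, if_neg hb']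
      simp only [e]
      ring
    all_goals rfl

/-! ## §2 Support and size -/

/-- [folklore] `|sEntry₂| ≤ 2`. -/
theorem abs_sEntry₂_le (κ : Fin (d + 1)) (u : Fin (d + 1) → ℤ) (κ' : Fin (d + 1)) (u' x w : Fin (d + 1) → ℤ) (α β : Fin (d + 1)) :
    |sEntry₂ d κ u κ' u' x w α β| ≤ 2 := by
  rw [sEntry₂_apply]
  split_ifs <;> norm_num

/-- [folklore] FINITE RANGE of the two-bond entry: it vanishes unless the row leg is within `ℓ¹`-distance 2 of the first bond, the column leg within 2 of the second, and
the two bonds within 2 of each other. -/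
theorem sEntry₂_eq_zero_or (κ : Fin (d + 1)) (u : Fin (d + 1) → ℤ) (κ' : Fin (d + 1)) (u' x w : Fin (d + 1) → ℤ) (α β : Fin (d + 1)) :
    sEntry₂ d κ u κ' u' x w α β = 0 ∨ (l1 (x - u) ≤ 2 ∧ l1 (w - u') ≤ 2 ∧ l1 (u' - u) ≤ 2) := by
  rw [sEntry₂_eq_sEntry]
  have l0 : ∀ y : Fin (d + 1) → ℤ, l1 (y - y) ≤ 2 := fun y => by rw [sub_self]; unfold B12Sec2to5.l1; simp
  by_cases hT : u + unitVec κ = u' + unitVec κ' ∧ (x = u ∧ α = κ) ∧ (w = u' ∧ β = κ')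
  · obtain ⟨hu, ⟨rfl, -⟩, ⟨rfl, -⟩⟩ := hT
    refine Or.inr ⟨l0 x, l0 w, ?_⟩
    have e : w - x = unitVec κ + -unitVec κ' := by linear_combination -hu
    rw [e]
    refine (l1_add_le _ _).trans ?_
    rw [l1_neg_eq, l1_unitVec, l1_unitVec]; norm_num
  · have hT0 : (if u + unitVec κ = u' + unitVec κ' then (1 : ℝ) else 0) * (if x = u ∧ α = κ then 1 else 0) * (if w = u' ∧ β = κ' then 1 else 0) = 0 := by
      by_cases h1 : u + unitVec κ = u' + unitVec κ'
      · by_cases h2 : x = u ∧ α = κ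
        · have h3 : ¬(w = u' ∧ β = κ') := fun h3 => hT ⟨h1, h2, h3⟩
          rw [if_neg h3, mul_zero]
        · rw [if_neg h2, mul_zero, zero_mul]
      · rw [if_neg h1, zero_mul, zero_mul]
    rw [hT0, zero_sub]
    by_cases hb : u = u' ∧ κ = κ'
    · obtain ⟨rfl, -⟩ := hb
      rcases sEntry_eq_zero_or κ u w x β α with h | ⟨hw, hx⟩
      · left; rw [h, mul_zero, neg_zero]
      · exact Or.inr ⟨hx, hw, l0 u⟩
    · left; rw [if_neg hb, mul_zero, zero_mul, neg_zero]

/-- [folklore] UNIFORM ENTRY BOUND `|sliceW| ≤ 4`. -/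
theorem abs_sliceW_le (κ : Fin (d + 1)) (u : Fin (d + 1) → ℤ) (κ' : Fin (d + 1)) (u' x w : Fin (d + 1) → ℤ) (a b : Fib d) :
    |sliceW d κ u κ' u' x w a b| ≤ 4 := by
  rcases a with α | α <;> rcases b with β | β
  · rw [sliceW_inl_inl, abs_neg]
    have h1 := abs_sEntry₂_le κ u κ' u' x w α β
    have h2 := abs_sEntry₂_le κ u κ' u' w x β α
    have h3 := abs_add_le (sEntry₂ d κ u κ' u' x w α β) (sEntry₂ d κ u κ' u' w x β α)
    linarith
  all_goals (show |(0 : ℝ)| ≤ 4; rw [abs_zero]; norm_num)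

/-- [folklore] **CO-LOCATED PAIRS ONLY**: the family VANISHES unless the two background bonds are within `ℓ¹`-distance 2 (`WilsonBiStencil.wilsonW₂_eq_zero_of_two_lt`'s twin). -/
theorem sliceW_eq_zero_of_two_lt {κ : Fin (d + 1)} {u : Fin (d + 1) → ℤ} {κ' : Fin (d + 1)} {u' : Fin (d + 1) → ℤ} (h : 2 < l1 (u' - u)) :
    sliceW d κ u κ' u' = 0 := by
  funext x w a b
  rcases a with α | α <;> rcases b with β | β
  · rw [sliceW_inl_inl]
    rcases sEntry₂_eq_zero_or κ u κ' u' x w α β with h1 | ⟨-, -, h1⟩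
    · rcases sEntry₂_eq_zero_or κ u κ' u' w x β α with h2 | ⟨-, -, h2⟩
      · rw [h1, h2, add_zero, neg_zero]; rfl
      · exact absurd h2 (not_le.2 h)
    · exact absurd h1 (not_le.2 h)
  all_goals rfl

/-! ## §3 The letters: `VertexFamily₂` and `LocStencil₂` shapes with explicit constants -/

/-- [folklore] ENTRY BOUND IN THE TWO-CENTRE SHAPE for any rate `δ ≥ 0`: `|sEntry₂ … x w α β| ≤ 2·e^{4δ}·e^{−δ(|x−u|₁ + |w−u′|₁)}`. -/
theorem abs_sEntry₂_le_exp_pair {δ : ℝ} (hδ : 0 ≤ δ) (κ : Fin (d + 1)) (u : Fin (d + 1) → ℤ) (κ' : Fin (d + 1)) (u' x w : Fin (d + 1) → ℤ)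
    (α β : Fin (d + 1)) :
    |sEntry₂ d κ u κ' u' x w α β| ≤ 2 * Real.exp (4 * δ) * Real.exp (-δ * (l1 (x - u) + l1 (w - u'))) := by
  rcases sEntry₂_eq_zero_or κ u κ' u' x w α β with h | ⟨hx, hw, -⟩
  · rw [h, abs_zero]; positivity
  · have h1 : 1 ≤ Real.exp (4 * δ) * Real.exp (-δ * (l1 (x - u) + l1 (w - u'))) := by
      rw [← Real.exp_add]
      exact Real.one_le_exp (by nlinarith [mul_nonneg hδ (sub_nonneg.2 hx), mul_nonneg hδ (sub_nonneg.2 hw)])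
    calc |sEntry₂ d κ u κ' u' x w α β| ≤ 2 * 1 := by rw [mul_one]; exact abs_sEntry₂_le κ u κ' u' x w α β
      _ ≤ 2 * (Real.exp (4 * δ) * Real.exp (-δ * (l1 (x - u) + l1 (w - u')))) := mul_le_mul_of_nonneg_left h1 (by norm_num)
      _ = _ := by ring

/-- [folklore] the transposed entry in the same two-centre shape (the bonds are within distance 2, so re-centring each leg costs `e^{2δ}`):
`|sEntry₂ … w x β α| ≤ 2·e^{8δ}·e^{−δ(|x−u|₁ + |w−u′|₁)}`. -/
theorem abs_sEntry₂_transpose_le_exp_pair {δ : ℝ} (hδ : 0 ≤ δ) (κ : Fin (d + 1)) (u : Fin (d + 1) → ℤ) (κ' : Fin (d + 1)) (u' x w : Fin (d + 1) → ℤ)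
    (α β : Fin (d + 1)) :
    |sEntry₂ d κ u κ' u' w x β α| ≤ 2 * Real.exp (8 * δ) * Real.exp (-δ * (l1 (x - u) + l1 (w - u'))) := by
  rcases sEntry₂_eq_zero_or κ u κ' u' w x β α with h | ⟨hw, hx, huu⟩
  · rw [h, abs_zero]; positivity
  · have hxu : l1 (x - u) ≤ 4 := by
      have e : x - u = (x - u') + (u' - u) := by abel
      rw [e]; exact (l1_add_le _ _).trans (by linarith)
    have hwu : l1 (w - u') ≤ 4 := by
      have e : w - u' = (w - u) + -(u' - u) := by abel
      rw [e]; refine (l1_add_le _ _).trans ?_; rw [l1_neg_eq]; linarith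
    have h1 : 1 ≤ Real.exp (8 * δ) * Real.exp (-δ * (l1 (x - u) + l1 (w - u'))) := by
      rw [← Real.exp_add]
      exact Real.one_le_exp (by nlinarith [mul_nonneg hδ (sub_nonneg.2 hxu), mul_nonneg hδ (sub_nonneg.2 hwu)])
    calc |sEntry₂ d κ u κ' u' w x β α| ≤ 2 * 1 := by rw [mul_one]; exact abs_sEntry₂_le κ u κ' u' w x β α
      _ ≤ 2 * (Real.exp (8 * δ) * Real.exp (-δ * (l1 (x - u) + l1 (w - u')))) := mul_le_mul_of_nonneg_left h1 (by norm_num)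
      _ = _ := by ring

/-- [folklore] **THE `VertexFamily₂` LETTER AT `N = 1`, EXPLICIT CONSTANT `Cw := 4·e^{8δ}`**: for every rate `δ ≥ 0`,
`BiLoc (sliceW d κ u κ′ u′) u u′ (4·e^{8δ}) δ` — the shape of the road's `hW : ∀ μ y ν y′, BiLoc (W μ y ν y′) y y′ Cw δ`. -/
theorem biLoc_sliceW_pair {δ : ℝ} (hδ : 0 ≤ δ) (κ : Fin (d + 1)) (u : Fin (d + 1) → ℤ) (κ' : Fin (d + 1)) (u' : Fin (d + 1) → ℤ) :
    BiLoc (sliceW d κ u κ' u') u u' (4 * Real.exp (8 * δ)) δ := by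
  intro x w a b
  have h0 : |(0 : ℝ)| ≤ 4 * Real.exp (8 * δ) * Real.exp (-δ * (l1 (x - u) + l1 (w - u'))) := by rw [abs_zero]; positivity
  rcases a with α | α <;> rcases b with β | β
  · rw [sliceW_inl_inl, abs_neg]
    have h1 := abs_sEntry₂_le_exp_pair hδ κ u κ' u' x w α β
    have h2 := abs_sEntry₂_transpose_le_exp_pair hδ κ u κ' u' x w α β
    have h3 := abs_add_le (sEntry₂ d κ u κ' u' x w α β) (sEntry₂ d κ u κ' u' w x β α)
    have h4 : Real.exp (4 * δ) ≤ Real.exp (8 * δ) := Real.exp_le_exp.2 (by linarith)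
    have h5 : 0 ≤ Real.exp (-δ * (l1 (x - u) + l1 (w - u'))) := (Real.exp_pos _).le
    nlinarith [h1, h2, h3, h4, h5]
  all_goals exact h0

/-- [folklore] **THE `LocStencil₂` LETTER (both legs centred at the FIRST bond, separation profile), EXPLICIT CONSTANT `CwL := 4·e^{12δ}`**: for every rate `δ ≥ 0`,
`BiLoc (sliceW d κ u κ′ u′) u u (4·e^{12δ}·e^{−δ|u′−u|₁}) δ` (`|w−u|₁ ≤ |w−u′|₁ + |u′−u|₁`, `|u′−u|₁ ≤ 2` on the support). -/
theorem biLoc_sliceW {δ : ℝ} (hδ : 0 ≤ δ) (κ : Fin (d + 1)) (u : Fin (d + 1) → ℤ) (κ' : Fin (d + 1)) (u' : Fin (d + 1) → ℤ) :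
    BiLoc (sliceW d κ u κ' u') u u (4 * Real.exp (12 * δ) * Real.exp (-δ * l1 (u' - u))) δ := by
  intro x w a b
  by_cases hfar : 2 < l1 (u' - u)
  · rw [sliceW_eq_zero_of_two_lt hfar]
    show |(0 : ℝ)| ≤ _
    rw [abs_zero]; positivity
  · have hfar : l1 (u' - u) ≤ 2 := not_lt.1 hfar
    have hp := biLoc_sliceW_pair hδ κ u κ' u' x w a b
    have htri : l1 (w - u) ≤ l1 (w - u') + l1 (u' - u) := by
      have e : w - u = (w - u') + (u' - u) := by abel
      rw [e]; exact l1_add_le _ _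
    have h1 : Real.exp (8 * δ) * Real.exp (-δ * (l1 (x - u) + l1 (w - u')))
        ≤ Real.exp (12 * δ) * Real.exp (-δ * l1 (u' - u)) * Real.exp (-δ * (l1 (x - u) + l1 (w - u))) := by
      rw [← Real.exp_add, ← Real.exp_add, ← Real.exp_add]
      exact Real.exp_le_exp.2 (by nlinarith [mul_nonneg hδ (sub_nonneg.2 hfar), mul_nonneg hδ (sub_nonneg.2 htri), mul_nonneg hδ (l1_nonneg (u' - u))])
    calc |sliceW d κ u κ' u' x w a b| ≤ 4 * Real.exp (8 * δ) * Real.exp (-δ * (l1 (x - u) + l1 (w - u'))) := hp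
      _ = 4 * (Real.exp (8 * δ) * Real.exp (-δ * (l1 (x - u) + l1 (w - u')))) := by ring
      _ ≤ 4 * (Real.exp (12 * δ) * Real.exp (-δ * l1 (u' - u)) * Real.exp (-δ * (l1 (x - u) + l1 (w - u)))) :=
          mul_le_mul_of_nonneg_left h1 (by norm_num)
      _ = _ := by ring

/-- [folklore] **`sliceW d` IS A `LocStencil₂` FAMILY** with constant `4·e^{12δ}` for every rate `δ ≥ 0` (the one-shot consumer's shape, `BalabanCompositeJets.LocStencil₂`). -/
theorem locStencil₂_sliceW {δ : ℝ} (hδ : 0 ≤ δ) : LocStencil₂ (sliceW d) (4 * Real.exp (12 * δ)) δ :=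
  fun κ u κ' u' => biLoc_sliceW hδ κ u κ' u'

/-! ## §4 Translation covariance -/

/-- [folklore] **FINE-TRANSLATION COVARIANCE**: `sliceW d κ (u + v) κ′ (u′ + v) = shiftK (−v) (sliceW d κ u κ′ u′)` (the shape of `StepJetData.wilsonA_translate` ∕
`WilsonBiStencil.wilsonW₂_translate` ∕ the road's `hcovW`). -/
theorem sliceW_translate (κ : Fin (d + 1)) (u : Fin (d + 1) → ℤ) (κ' : Fin (d + 1)) (u' v : Fin (d + 1) → ℤ) :
    sliceW d κ (u + v) κ' (u' + v) = shiftK (-v) (sliceW d κ u κ' u') := by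
  funext x w a b
  show sliceW d κ (u + v) κ' (u' + v) x w a b = sliceW d κ u κ' u' (x + -v) (w + -v) a b
  rcases a with α | α <;> rcases b with β | β
  · rw [sliceW_inl_inl, sliceW_inl_inl, sEntry₂_translate, sEntry₂_translate, ← sub_eq_add_neg x v, ← sub_eq_add_neg w v]
  all_goals rfl

end Summit.QuantumFields.BalabanUV.Beta.FP.SliceBiStencil

end
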